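import Summits.CriticalPhenomena.PercolationContinuityZ3.Theorems.PercNearOneGluingNoHeavyLowerTailSahiLCExmaxRefutation
import Mathlib
import HarnessLib
import HarnessLib.Audit.Tags

/-!
# `NoHeavyLowerTail` (crux stmt-CriticalPhenomena-4575), master-family line P1 (gen 19):
# the ONE-PAYER DICHOTOMY FAILS ON A BLOCK COMPOSITE — EXMAX is violated at ACHIEVABLE (OR-block) weights (kernel),
# hence `¬ PivotDichotomy 3` modulo the OR-block calculus identity

Support file (seat `prim-masterthm-p1`, gen 19; `--supports stmt-CriticalPhenomena-4575`), on top of `…SahiLCExmaxRefutation` (gen 18: the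
`ℤ`-valued sums `wRainbowSumInt`/`wSideSumInt` and their cast lemmas), `…SahiExchangeableLC` (gen 17), `…SahiPivotDichotomy` (gen 16: typed
`PivotDichotomy`), `…SahiPivotFamilyRefutation` (gen 15: `lab3`).  Memo `run/shared/lean/prim/prim-masterthm/FROM-prim-masterthm-p1-g19-ULC-REFUTATION.md` §8.

THE WITNESS.  Base system on five meta-coordinates `F0c = lab3 (g₁, g₂, g₃)` with `g₁ = ↑{1,3} ∪ ↑{2,3,4} ∪ ↑{0,1,2,4}`, `g₂ = ↑{0,3,4}`,
`g₃ = ↑{0,2} ∪ ↑{0,1,4}` (label string `BBBBB3B3BB11B31ABBB3B3BAB21A1A1A`, a monotone sunflower labeling, `F0c_mono`), and the block statistics of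
OR-blocks of sizes `(3, 1, 1, 6, 8)`: `w_j = (0, 1, 2^n−2, 3^n−3·2^n+3)` (`orStat`; an OR-block of size `n` is met by exactly `c` of the three cells of an
ordered tripartition in that many ways).  KERNEL VALUES (`decide +kernel`, 32 768-term sums): `T = 32 555 232`, `Φ_A = 32 511 888`, `Φ_B = 30 348 288`
— **`T > Φ_A` and `T > Φ_B`** (`exmax_fails_at_orBlockStats`): the exchangeable-weight one-payer inequality FAILS at weights that ARE tripartition
statistics of monotone blocks (contrast: gen 18's LC-EXMAX witness used the non-achievable twisted vertex `δ₂`).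
By the block calculus (memo g16 §3: every fibre functional of a block composite `F₀∘(c₁,…,c_m)` is the exchangeable-weight functional of `F₀` at the
blocks' statistics) these three numbers ARE `T, 3S_A, 3S_B` of the monotone labeling `orComposite 5 blk F0c` on the 19 coordinates `{0,…,18}`
(block `j` "on" iff the cell meets it) — confirmed OUTSIDE the kernel by direct enumeration of all `3¹⁹` ordered tripartitions (code-g19/pdcex19.c) — so
`PivotDichotomy 3` ("one payer suffices on every pure fibre", gen 16) is FALSE.  In the kernel this file proves the implication from the OR-block calculus
identity, stated as `OrBlockCalculus` (a true counting identity — tripartitions of a disjoint union of blocks ↔ tuples of block tripartitions, grouped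
by which cells meet which block; paper proof memo g16 §3; its formalization is the remaining step): `not_pivotDichotomy_three_of_orBlockCalculus`.
NOT TOUCHED: CP3⁺ (`T ≤ 3S_A + 3S_B` holds for the witness: "needs both payers"), S₃^max (`StrongCubicMaxNonneg`; the base over a 19⁵ bias grid stays
≤ 0.877), S₃, the class law; and EXMAX for the 4-coordinate mixed system `S*` holds for ALL weights (gen 19 `…SahiExmaxSstar`).
HONEST FRAMING: unconditional kernel content = the achievable-weight EXMAX violation; the refutation of the typed `PivotDichotomy 3` is CONDITIONAL on
`OrBlockCalculus`. [this work]
-/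

namespace Summit.CriticalPhenomena.PercolationContinuityZ3.Theorems

namespace SahiPivotFamily

open Finset AntipodalStrongHarris AntipodalStrongHarris.Lab

/-! ### 1. The base system and the OR-block weights -/

/-- Generator `g₁ = [1∧3] ∨ [2∧3∧4] ∨ [0∧1∧2∧4]`. [this work] -/
def cg1 (X : Finset ℕ) : Bool :=
  (decide (1 ∈ X) && decide (3 ∈ X)) || (decide (2 ∈ X) && decide (3 ∈ X) && decide (4 ∈ X)) ||
    (decide (0 ∈ X) && decide (1 ∈ X) && decide (2 ∈ X) && decide (4 ∈ X))
/-- Generator `g₂ = [0∧3∧4]`. [this work] -/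
def cg2 (X : Finset ℕ) : Bool := decide (0 ∈ X) && decide (3 ∈ X) && decide (4 ∈ X)
/-- Generator `g₃ = [0∧2] ∨ [0∧1∧4]`. [this work] -/
def cg3 (X : Finset ℕ) : Bool := (decide (0 ∈ X) && decide (2 ∈ X)) || (decide (0 ∈ X) && decide (1 ∈ X) && decide (4 ∈ X))

/-- **The base system** `F0c = lab3 (g₁,g₂,g₃)` (`BBBBB3B3BB11B31ABBB3B3BAB21A1A1A` on the subsets of `{0,…,4}`). [this work] -/
def F0c (X : Finset ℕ) : Lab 3 := lab3 (cg1 X) (cg2 X) (cg3 X)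

/-- `F0c` is a sunflower labeling (monotone). [this work] -/
theorem F0c_mono : ∀ ⦃X Y : Finset ℕ⦄, X ⊆ Y → F0c X ≤ F0c Y := by
  intro X Y hXY
  unfold F0c
  have h : ∀ n : ℕ, decide (n ∈ X) = true → decide (n ∈ Y) = true := fun n hn => by
    simp only [decide_eq_true_eq] at hn ⊢; exact hXY hn
  apply lab3_mono <;> simp only [cg1, cg2, cg3, Bool.and_eq_true, Bool.or_eq_true] <;> aesop

/-- Statistics of an OR-block of size `n ≥ 1`: an ordered tripartition of the block meets exactly `c` prescribed cells in
`(0, 1, 2^n − 2, 3^n − 3·2^n + 3)_c` ways. [this work] -/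
def orStat (n : ℕ) (c : ℕ) : ℤ :=
  if c = 1 then 1 else if c = 2 then 2 ^ n - 2 else if c = 3 then 3 ^ n - 3 * 2 ^ n + 3 else 0

/-- The blocks of the witness: sizes `(3, 1, 1, 6, 8)` on the coordinates `0…18`. [this work] -/
def blk (j : ℕ) : Finset ℕ :=
  if j = 0 then {0, 1, 2} else if j = 1 then {3} else if j = 2 then {4}
  else if j = 3 then {5, 6, 7, 8, 9, 10} else if j = 4 then {11, 12, 13, 14, 15, 16, 17, 18} else ∅

/-- The OR-block statistics of the witness as a literal table (`(0,1,6,6), δ₁, δ₁, (0,1,62,540), (0,1,254,5796)`; the value at `j ≥ 5`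
is `orStat 0`, irrelevant). [this work] -/
def orWt5 (j c : ℕ) : ℤ :=
  if j = 0 then (if c = 1 then 1 else if c = 2 then 6 else if c = 3 then 6 else 0)
  else if j = 1 ∨ j = 2 then (if c = 1 then 1 else 0)
  else if j = 3 then (if c = 1 then 1 else if c = 2 then 62 else if c = 3 then 540 else 0)
  else if j = 4 then (if c = 1 then 1 else if c = 2 then 254 else if c = 3 then 5796 else 0)
  else (if c = 1 then 1 else if c = 2 then -1 else if c = 3 then 1 else 0)

/-- The literal table is the OR-block statistics of the blocks `blk`. [this work] -/
theorem orStat_blk : (fun j => orStat (blk j).card) = orWt5 := by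
  funext j c
  simp only [orStat, orWt5, blk]
  by_cases h0 : j = 0
  · subst h0; simp
  by_cases h1 : j = 1
  · subst h1; simp
  by_cases h2 : j = 2
  · subst h2; simp
  by_cases h3 : j = 3
  · subst h3; simp
  by_cases h4 : j = 4
  · subst h4; simp
  simp [h0, h1, h2, h3, h4]

/-! ### 2. Kernel evaluation of the three exchangeable-weight sums at the OR-block statistics
(the outer sum is split into four classes of first sets, `decide +kernel` on 8 192-term pieces) -/

/-- The inner double sum of `wRainbowSumInt` at a fixed first set. [this work] -/
def innerR (x : Finset ℕ) : ℤ :=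
  ∑ y ∈ (range 5).powerset, ∑ z ∈ (range 5).powerset, tripleWeightInt (range 5) orWt5 x y z * rainbow (F0c x) (F0c y) (F0c z)

/-- The inner double sum of `wSideSumInt` at a fixed first set. [this work] -/
def innerS (a : Lab 3) (x : Finset ℕ) : ℤ :=
  ∑ y ∈ (range 5).powerset, ∑ z ∈ (range 5).powerset,
    if F0c x = a then tripleWeightInt (range 5) orWt5 x y z * (3 * kappa (F0c y) (F0c z)) else 0

/-- Classes of first sets by a membership pattern. [this work] -/
def pcls (l : List (ℕ × Bool)) : Finset (Finset ℕ) := (range 5).powerset.filter fun x => ∀ p ∈ l, (p.1 ∈ x ↔ p.2 = true)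

/-- The empty pattern is everything. [this work] -/
theorem pcls_nil : pcls [] = (range 5).powerset := by ext x; simp [pcls]

/-- Splitting a class by one more point. [this work] -/
theorem sum_pcls_cons (l : List (ℕ × Bool)) (i : ℕ) (g : Finset ℕ → ℤ) :
    ∑ x ∈ pcls l, g x = ∑ x ∈ pcls ((i, true) :: l), g x + ∑ x ∈ pcls ((i, false) :: l), g x := by
  rw [← sum_filter_add_sum_filter_not (pcls l) (fun x => i ∈ x) g]
  congr 1
  · congr 1; ext x; simp only [pcls, mem_filter, List.forall_mem_cons]; tauto
  · congr 1; ext x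
    simp only [pcls, mem_filter, List.forall_mem_cons, Bool.false_eq_true, iff_false]; tauto

set_option maxRecDepth 1000000 in
set_option maxHeartbeats 4000000 in -- kernel evaluation of an 8 192-term piece (one-off certificate check)
/-- Class `[(1, true), (0, true)]`, R-piece. [this work] -/
theorem pclsR_1 : ∑ x ∈ pcls [(1, true), (0, true)], innerR x = 4508424 := by decide +kernel

set_option maxRecDepth 1000000 in
set_option maxHeartbeats 4000000 in -- kernel evaluation of an 8 192-term piece (one-off certificate check)
/-- Class `[(1, true), (0, true)]`, A-piece. [this work] -/
theorem pclsA_1 : ∑ x ∈ pcls [(1, true), (0, true)], innerS top x = 18441360 := by decide +kernel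

set_option maxRecDepth 1000000 in
set_option maxHeartbeats 4000000 in -- kernel evaluation of an 8 192-term piece (one-off certificate check)
/-- Class `[(1, true), (0, true)]`, B-piece. [this work] -/
theorem pclsB_1 : ∑ x ∈ pcls [(1, true), (0, true)], innerS bot x = 11412 := by decide +kernel

set_option maxRecDepth 1000000 in
set_option maxHeartbeats 4000000 in -- kernel evaluation of an 8 192-term piece (one-off certificate check)
/-- Class `[(1, false), (0, true)]`, R-piece. [this work] -/
theorem pclsR_2 : ∑ x ∈ pcls [(1, false), (0, true)], innerR x = 17391264 := by decide +kernel

set_option maxRecDepth 1000000 in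
set_option maxHeartbeats 4000000 in -- kernel evaluation of an 8 192-term piece (one-off certificate check)
/-- Class `[(1, false), (0, true)]`, A-piece. [this work] -/
theorem pclsA_2 : ∑ x ∈ pcls [(1, false), (0, true)], innerS top x = 14070528 := by decide +kernel

set_option maxRecDepth 1000000 in
set_option maxHeartbeats 4000000 in -- kernel evaluation of an 8 192-term piece (one-off certificate check)
/-- Class `[(1, false), (0, true)]`, B-piece. [this work] -/
theorem pclsB_2 : ∑ x ∈ pcls [(1, false), (0, true)], innerS bot x = 3606804 := by decide +kernel

set_option maxRecDepth 1000000 in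
set_option maxHeartbeats 4000000 in -- kernel evaluation of an 8 192-term piece (one-off certificate check)
/-- Class `[(1, true), (0, false)]`, R-piece. [this work] -/
theorem pclsR_3 : ∑ x ∈ pcls [(1, true), (0, false)], innerR x = 6343320 := by decide +kernel

set_option maxRecDepth 1000000 in
set_option maxHeartbeats 4000000 in -- kernel evaluation of an 8 192-term piece (one-off certificate check)
/-- Class `[(1, true), (0, false)]`, A-piece. [this work] -/
theorem pclsA_3 : ∑ x ∈ pcls [(1, true), (0, false)], innerS top x = 0 := by decide +kernel

set_option maxRecDepth 1000000 in
set_option maxHeartbeats 4000000 in -- kernel evaluation of an 8 192-term piece (one-off certificate check)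
/-- Class `[(1, true), (0, false)]`, B-piece. [this work] -/
theorem pclsB_3 : ∑ x ∈ pcls [(1, true), (0, false)], innerS bot x = 132690 := by decide +kernel

set_option maxRecDepth 1000000 in
set_option maxHeartbeats 4000000 in -- kernel evaluation of an 8 192-term piece (one-off certificate check)
/-- Class `[(1, false), (0, false)]`, R-piece. [this work] -/
theorem pclsR_4 : ∑ x ∈ pcls [(1, false), (0, false)], innerR x = 4312224 := by decide +kernel

set_option maxRecDepth 1000000 in
set_option maxHeartbeats 4000000 in -- kernel evaluation of an 8 192-term piece (one-off certificate check)
/-- Class `[(1, false), (0, false)]`, A-piece. [this work] -/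
theorem pclsA_4 : ∑ x ∈ pcls [(1, false), (0, false)], innerS top x = 0 := by decide +kernel

set_option maxRecDepth 1000000 in
set_option maxHeartbeats 4000000 in -- kernel evaluation of an 8 192-term piece (one-off certificate check)
/-- Class `[(1, false), (0, false)]`, B-piece. [this work] -/
theorem pclsB_4 : ∑ x ∈ pcls [(1, false), (0, false)], innerS bot x = 26597382 := by decide +kernel

/-- `T = 32 555 232`. [this work] -/
theorem rainbow_val_or : wRainbowSumInt (range 5) (fun j => orStat (blk j).card) F0c = 32555232 := by
  rw [orStat_blk]
  show ∑ x ∈ (range 5).powerset, innerR x = 32555232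
  rw [← pcls_nil, sum_pcls_cons [] 0, sum_pcls_cons [(0, true)] 1, sum_pcls_cons [(0, false)] 1, pclsR_1, pclsR_2, pclsR_3, pclsR_4]
  norm_num

/-- `Φ_A = 32 511 888`. [this work] -/
theorem sideA_val_or : wSideSumInt (range 5) (fun j => orStat (blk j).card) F0c top = 32511888 := by
  rw [orStat_blk]
  show ∑ x ∈ (range 5).powerset, innerS top x = 32511888
  rw [← pcls_nil, sum_pcls_cons [] 0, sum_pcls_cons [(0, true)] 1, sum_pcls_cons [(0, false)] 1, pclsA_1, pclsA_2, pclsA_3, pclsA_4]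
  norm_num

/-- `Φ_B = 30 348 288`. [this work] -/
theorem sideB_val_or : wSideSumInt (range 5) (fun j => orStat (blk j).card) F0c bot = 30348288 := by
  rw [orStat_blk]
  show ∑ x ∈ (range 5).powerset, innerS bot x = 30348288
  rw [← pcls_nil, sum_pcls_cons [] 0, sum_pcls_cons [(0, true)] 1, sum_pcls_cons [(0, false)] 1, pclsB_1, pclsB_2, pclsB_3, pclsB_4]
  norm_num

/-- **THEOREM: EXMAX fails at ACHIEVABLE weights.**  At the OR-block statistics `(0,1,6,6), (0,1,0,0), (0,1,0,0), (0,1,62,540), (0,1,254,5796)` the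
rainbow sum of the sunflower labeling `F0c` exceeds BOTH side sums: `T > Φ_A` and `T > Φ_B` (while `T ≤ Φ_A + Φ_B`). [this work] -/
theorem exmax_fails_at_orBlockStats :
    wSideSumInt (range 5) (fun j => orStat (blk j).card) F0c top < wRainbowSumInt (range 5) (fun j => orStat (blk j).card) F0c ∧
    wSideSumInt (range 5) (fun j => orStat (blk j).card) F0c bot < wRainbowSumInt (range 5) (fun j => orStat (blk j).card) F0c ∧
    wRainbowSumInt (range 5) (fun j => orStat (blk j).card) F0c ≤
      wSideSumInt (range 5) (fun j => orStat (blk j).card) F0c top + wSideSumInt (range 5) (fun j => orStat (blk j).card) F0c bot := by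
  have key : ∀ T A B : ℤ, T = 32555232 → A = 32511888 → B = 30348288 → (A < T ∧ B < T ∧ T ≤ A + B) := by
    intro T A B hT hA hB; subst hT hA hB; norm_num
  exact key _ _ _ rainbow_val_or sideA_val_or sideB_val_or

/-- The same in the real exchangeable-weight vocabulary of `…SahiExchangeableLC` (`wRainbowSum`, `wSideSum`). [this work] -/
theorem exmax_fails_at_orBlockStats_real :
    wSideSum (range 5) (fun j c => (orStat (blk j).card c : ℝ)) F0c top < wRainbowSum (range 5) (fun j c => (orStat (blk j).card c : ℝ)) F0c ∧
    wSideSum (range 5) (fun j c => (orStat (blk j).card c : ℝ)) F0c bot < wRainbowSum (range 5) (fun j c => (orStat (blk j).card c : ℝ)) F0c := by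
  rw [wSideSum_intCast, wSideSum_intCast, wRainbowSum_intCast]
  obtain ⟨h1, h2, -⟩ := exmax_fails_at_orBlockStats
  exact ⟨by exact_mod_cast h1, by exact_mod_cast h2⟩

/-! ### 3. The OR-composite and the conditional refutation of the one-payer dichotomy -/

variable {k : ℕ}

/-- **OR-composite** of a base labeling `F₀` along blocks `B 0, …, B (m−1)`: meta-coordinate `j` is on for `X` iff `X` meets `B j`. [this work] -/
def orComposite (m : ℕ) (B : ℕ → Finset ℕ) (F₀ : Finset ℕ → Lab k) (X : Finset ℕ) : Lab k :=
  F₀ ((range m).filter fun j => (X ∩ B j).Nonempty)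

/-- An OR-composite of a sunflower labeling is a sunflower labeling. [this work] -/
theorem orComposite_mono (m : ℕ) (B : ℕ → Finset ℕ) {F₀ : Finset ℕ → Lab k} (hF : ∀ ⦃X Y : Finset ℕ⦄, X ⊆ Y → F₀ X ≤ F₀ Y) :
    ∀ ⦃X Y : Finset ℕ⦄, X ⊆ Y → orComposite m B F₀ X ≤ orComposite m B F₀ Y := by
  intro X Y hXY
  unfold orComposite
  apply hF
  intro j hj
  rw [mem_filter] at hj ⊢
  exact ⟨hj.1, hj.2.mono (inter_subset_inter hXY subset_rfl)⟩

/-- **The OR-block calculus identity** (memo g16 §3, proved there on paper; instances re-verified by enumeration, memo g19 §8): for pairwise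
disjoint nonempty blocks, every pure-fibre functional of the OR-composite equals the exchangeable-weight functional of the base at the OR-block
statistics (ordered tripartitions of the union ↔ tuples of block tripartitions, grouped by which cells meet which block).  Stated here as a
hypothesis (tagged like the line's other typed statements; it is a routine counting identity, NOT a research conjecture); its formalization is
the remaining step to an unconditional kernel refutation. [this work] [status: open] -/
@[conjecture] def OrBlockCalculus : Prop :=
  ∀ (k m : ℕ) (B : ℕ → Finset ℕ) (F₀ : Finset ℕ → Lab k),
    (∀ i < m, ∀ j < m, i ≠ j → Disjoint (B i) (B j)) → (∀ j < m, (B j).Nonempty) →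
      rainbowSum ((range m).biUnion B) (orComposite m B F₀) = wRainbowSumInt (range m) (fun j => orStat (B j).card) F₀ ∧
      ∀ a : Lab k, sideSum ((range m).biUnion B) (orComposite m B F₀) a = wSideSumInt (range m) (fun j => orStat (B j).card) F₀ a

/-- The witness blocks are pairwise disjoint. [this work] -/
theorem blk_disjoint : ∀ i < 5, ∀ j < 5, i ≠ j → Disjoint (blk i) (blk j) := by decide

/-- The witness blocks are nonempty. [this work] -/
theorem blk_nonempty : ∀ j < 5, (blk j).Nonempty := by decide

/-- **THEOREM (conditional refutation): the OR-block calculus identity implies `¬ PivotDichotomy 3`.**  The monotone labeling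
`orComposite 5 blk F0c` on `{0,…,18}` has `T = 32 555 232 > 3S_A = 32 511 888 > 3S_B = 30 348 288` — both payers fail. [this work] -/
theorem not_pivotDichotomy_three_of_orBlockCalculus (hBC : OrBlockCalculus) : ¬ PivotDichotomy 3 := by
  intro h
  obtain ⟨hT, hS⟩ := hBC 3 5 blk F0c blk_disjoint blk_nonempty
  have hA := hS top
  have hB := hS bot
  have hdich := h ((range 5).biUnion blk) (orComposite 5 blk F0c) (orComposite_mono 5 blk F0c_mono)
  -- values through fresh variables (no unification of closed counting terms)
  have key : ∀ T A B T' A' B' : ℤ, (T ≤ A ∨ T ≤ B) → T = T' → A = A' → B = B' →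
      T' = 32555232 → A' = 32511888 → B' = 30348288 → False := by
    intro T A B T' A' B' hd e1 e2 e3 v1 v2 v3; subst e1 e2 e3 v1 v2 v3; norm_num at hd
  exact key _ _ _ _ _ _ hdich hT hA hB rainbow_val_or sideA_val_or sideB_val_or

end SahiPivotFamily

end Summit.CriticalPhenomena.PercolationContinuityZ3.Theorems
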